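import Summits.CriticalPhenomena.PercolationContinuityZ3.Theorems.Transplant.FKConnectivityAllQSPUpCorr
import Summits.CriticalPhenomena.PercolationContinuityZ3.Theorems.Transplant.FKConnectivityAllQSPTwoTreeBridge
import Summits.CriticalPhenomena.PercolationContinuityZ3.Theorems.Transplant.FKConnectivityAllQConnUpCorr
import HarnessLib

/-!
# Connectivity correlation inequalities for `φ_{w,q}`, every `q > 0` — file 14c: CONDITIONING ON A CONNECTION RAISES THE MEASURE
# on two-terminal series–parallel supports (every `q > 0`), and SINGLE-EDGE NEGATIVE DEPENDENCE of `φ_{p,q}`, `0 < q < 1`, at every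
# edge of every series–parallel support — UNCONDITIONAL

Support file (`--supports stmt-CriticalPhenomena-4575`), FK sub-lane `prim-bschramm-fk-2` (gen 8) of the post-continuity
programme; builds on p205010 (kernel theorem, internal audit signed; external expert review pending).  No definitions, no named
facts, no sorries; standard axioms.

Gen 6 (`…AllQConnUpCorr.lean`) isolated, for `0 < q < 1`, the two equivalent statements at the TOP of the lane's hierarchy of
connectivity inequalities — UPC `φ(x↔y)·φ(F) ≤ φ({x↔y} ∩ F)` (conditioning on a two-point connection raises every increasing event)
and CD `φ(J_e ∩ F) ≤ φ(J_e)·φ(F)` (an open edge lowers every increasing event of the other edges: negative association with a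
singleton block, Grimmett 2006 §3.9 second notion; Pemantle's negative regression dependence) — both conjectural for `q < 1` on
general graphs (NA ⇒ CD ⟺ UPC ⇒ {NC ⟺ EC⁺} ⇒ PC2 ⇒ HUB).  Gen 7 proved the pairwise level {NC, EC⁺} on two-terminal series–parallel
networks (`FK.IsTTSP`; Wagner 2008).  This file proves the TOP level on the same class, from the induction `FK.upcNet_of_isTTSP`
of `…AllQSPUpCorr.lean`:
* **`FK.connUpCorr_of_isTTSP`** (every `q > 0`): `E` TTSP between `x, y`, `w` supported in `E`, `F` increasing ⇒
  `φ_{w,q}(x ↔ y)·φ_{w,q}(F) ≤ φ_{w,q}({x ↔ y} ∩ F)`; `FK.condConn_dom_of_isTTSP`: `φ(F ∩ {x↮y})·φ(x↔y) ≤ φ(F ∩ {x↔y})·φ(x↮y)`,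
  i.e. `φ(· | x ↔ y) ≽ φ(· | x ↮ y)` event-wise.  For `q ≥ 1` this is FKG; for `q < 1` it is new as far as searched.
* `FK.edgeNegDep_of_connUpCorr_at` (`0 < q < 1`): the pointwise form of gen 6's `edgeNegDepOn_of_connUpCorrOn` — UPC at
  `(w[e↦0]; x, y; F)` gives CD at `(w; e = xy; F)` (duality `FK.openPair_defect_eq_neg_conn_defect`).
* **`FK.edgeNegDep_of_isTTSP`**, **`FK.edgeNegDep_supp_of_isTTSP`** (`0 < q < 1`): for `E` TTSP between `s, t` and `w` supported in
  `E ∪ {st}` — every 2-connected series–parallel weighted graph presented from one of its edges (Duffin 1965) — and EVERY pair `e`,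
  every increasing event `F` not depending on `e`: `φ_{w,q}(J_e ∩ F) ≤ φ_{w,q}(J_e)·φ_{w,q}(F)`.  As the weights are arbitrary in
  `[0,1]` (weight `0` = deletion, weight `1` = contraction) this is negative regression dependence of `φ_{G,𝐩,q}`, `q < 1`, on
  series–parallel graphs, STABLE UNDER EXTERNAL FIELDS AND CONDITIONING ON EDGE STATES (Pemantle 2000's JNRD⁺ with conditioning);
  `F = J_f` recovers Wagner's theorem (`FK.edgeNegCorr_supp_of_isTTSP`).  Borcea–Brändén–Liggett 2009 §3.4: already on a cycle the
  `q < 1` random-cluster measure is Rayleigh but NOT strongly Rayleigh, so this does not follow from the strongly-Rayleigh theory;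
  Pemantle's conjecture 'Rayleigh/h-NLC⁺ ⇒ CNA⁺' (BBL Conj. 2.6) is open.
* 2-tree supports (fk-1 g5's class, bridge `IsTTSP.of_isTwoTree`): `FK.connUpCorr_of_isTwoTree_of_pos`, `FK.edgeNegDep_of_isTwoTree`.
[cite: Grimmett2006, §3.9 (pp. 63–64); Thm. (3.8); §3.8 Thm. (3.90)–(3.91) (pp. 61–62); §1.4 eq. (1.20) (p. 15)]
[cite: Wagner2006, Thm. 5.8(d), §5.3] [cite: BorceaBrandenLiggett2007, §2.1 Def. 2.4–2.7, Conj. 2.6, §3.4]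
-/

noncomputable section

namespace Summit.CriticalPhenomena.PercolationContinuityZ3.Theorems

namespace FK

open MeasureTheory Set SimpleGraph Literature.Probability.LatticeModels Literature.Probability.Percolation
open Literature.Probability.Percolation.DecisionTree (ind ind_of_mem ind_of_not_mem ind_nonneg)
open scoped Classical symmDiff

variable {V : Type*} [Fintype V]

/-! ### UPC on two-terminal series–parallel supports, every `q > 0` -/

/-- **Conditioning on the connection of the terminals raises every increasing event, every `q > 0`**: if `E` is a two-terminal
series–parallel network between `x` and `y` and `w` is supported in `E`, then for every increasing event `F`,
`φ_{w,q}(x ↔ y)·φ_{w,q}(F) ≤ φ_{w,q}({x ↔ y} ∩ F)`.  (`q ≥ 1`: FKG, Grimmett Thm. (3.8); `q < 1`: the instance on this class of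
gen 6's conjecture node `ConnUpCorrFKPos`.) [cite: Grimmett2006, Thm. (3.8); §3.9 (pp. 63–64)] [cite: Wagner2006, Thm. 5.8(d), §5.3] -/
theorem connUpCorr_of_isTTSP {q : ℝ} (hq : 0 < q) {E : Finset (Sym2 V)} {x y : V} (hE : IsTTSP E x y)
    (w : Sym2 V → unitInterval) (hw : ∀ e, ((w e : unitInterval) : ℝ) ≠ 0 → e ∈ (↑E : Set (Sym2 V)))
    {F : Set (BondConfig V)} (hF : IsUpperSet F) :
    (rcMeasureW w q ∅).real (openConn x y) * (rcMeasureW w q ∅).real F ≤ (rcMeasureW w q ∅).real (openConn x y ∩ F) := by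
  have hnet := upcNet_of_isTTSP w hq hE F hF
  have hS : ∀ A : Set (BondConfig V), netMass w q (↑E : Set (Sym2 V)) A = ∑ ω : BondConfig V, rcWeightW w q ∅ ω * ind A ω :=
    fun A => (sum_rcWeightW_ind_eq_netMass w q hw A).symm
  rw [hS, hS, hS, hS, Set.inter_comm (openConn x y)ᶜ F, sum_rcWeightW_ind_inter_compl w q F (openConn x y),
    sum_rcWeightW_ind_compl w q (openConn x y), Set.inter_comm F (openConn x y)] at hnet
  have hZ := rcPartitionFunctionW_pos w hq (∅ : Set V)
  rw [rcMeasureW_real_eq_sum_div w hq ∅, rcMeasureW_real_eq_sum_div w hq ∅, rcMeasureW_real_eq_sum_div w hq ∅,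
    div_mul_div_comm, div_le_div_iff₀ (mul_pos hZ hZ) hZ]
  nlinarith [hnet, hZ]

/-- **Event-wise stochastic domination `φ(· | x ↔ y) ≽ φ(· | x ↮ y)` on two-terminal series–parallel supports, every `q > 0`**:
`φ({x↮y} ∩ F)·φ(x↔y) ≤ φ({x↔y} ∩ F)·φ(x↮y)` for every increasing `F`. [cite: Grimmett2006, §3.9 (pp. 63–64); Thm. (3.8)] -/
theorem condConn_dom_of_isTTSP {q : ℝ} (hq : 0 < q) {E : Finset (Sym2 V)} {x y : V} (hE : IsTTSP E x y)
    (w : Sym2 V → unitInterval) (hw : ∀ e, ((w e : unitInterval) : ℝ) ≠ 0 → e ∈ (↑E : Set (Sym2 V)))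
    {F : Set (BondConfig V)} (hF : IsUpperSet F) :
    (rcMeasureW w q ∅).real ((openConn x y)ᶜ ∩ F) * (rcMeasureW w q ∅).real (openConn x y) ≤
      (rcMeasureW w q ∅).real (openConn x y ∩ F) * (rcMeasureW w q ∅).real (openConn x y)ᶜ := by
  have hnet := upcNet_of_isTTSP w hq hE F hF
  have hS : ∀ A : Set (BondConfig V), netMass w q (↑E : Set (Sym2 V)) A = ∑ ω : BondConfig V, rcWeightW w q ∅ ω * ind A ω :=
    fun A => (sum_rcWeightW_ind_eq_netMass w q hw A).symm
  rw [hS, hS, hS, hS] at hnet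
  have hZ := rcPartitionFunctionW_pos w hq (∅ : Set V)
  rw [rcMeasureW_real_eq_sum_div w hq ∅, rcMeasureW_real_eq_sum_div w hq ∅, rcMeasureW_real_eq_sum_div w hq ∅,
    rcMeasureW_real_eq_sum_div w hq ∅, div_mul_div_comm, div_mul_div_comm, div_le_div_iff₀ (mul_pos hZ hZ) (mul_pos hZ hZ)]
  exact mul_le_mul_of_nonneg_right hnet (mul_pos hZ hZ).le

/-! ### Single-edge negative dependence from UPC, pointwise (`0 < q < 1`) -/

/-- **UPC one edge down gives CD at that edge** (`0 < q < 1`, pointwise form of gen 6's `FK.edgeNegDepOn_of_connUpCorrOn`): for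
`e = s(x,y)`, an event `F` not depending on `e`, and the UPC instance `φ_{w[e↦0]}(x↔y)·φ_{w[e↦0]}(F) ≤ φ_{w[e↦0]}({x↔y} ∩ F)`, one
has `φ_w(J_e ∩ F) ≤ φ_w(J_e)·φ_w(F)` (duality `FK.openPair_defect_eq_neg_conn_defect`). [cite: Grimmett2006, §3.9 (pp. 63–64); Thm. (3.1)(a) (p. 37)] -/
theorem edgeNegDep_of_connUpCorr_at {q : ℝ} (hq0 : 0 < q) (hq1 : q < 1) (w : Sym2 V → unitInterval) (x y : V)
    {F : Set (BondConfig V)} (hFe : ∀ ω : BondConfig V, ω ∆ {s(x, y)} ∈ F ↔ ω ∈ F)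
    (hU : (rcMeasureW (Function.update w s(x, y) 0) q ∅).real (openConn x y) *
        (rcMeasureW (Function.update w s(x, y) 0) q ∅).real F ≤
      (rcMeasureW (Function.update w s(x, y) 0) q ∅).real (openConn x y ∩ F)) :
    (rcMeasureW w q ∅).real ({ω | s(x, y) ∈ ω} ∩ F) ≤
      (rcMeasureW w q ∅).real {ω | s(x, y) ∈ ω} * (rcMeasureW w q ∅).real F := by
  have hZ := rcPartitionFunctionW_pos w hq0 (∅ : Set V)
  rw [rcMeasureW_real_eq_sum_div w hq0 ∅, rcMeasureW_real_eq_sum_div w hq0 ∅, rcMeasureW_real_eq_sum_div w hq0 ∅,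
    div_mul_div_comm, div_le_div_iff₀ hZ (mul_pos hZ hZ)]
  suffices hdef : (∑ ω : BondConfig V, rcWeightW w q ∅ ω * ind ({ω | s(x, y) ∈ ω} ∩ F) ω) * rcPartitionFunctionW w q ∅ -
      (∑ ω : BondConfig V, rcWeightW w q ∅ ω * ind {ω | s(x, y) ∈ ω} ω) *
        (∑ ω : BondConfig V, rcWeightW w q ∅ ω * ind F ω) ≤ 0 by
    have h2 := mul_le_mul_of_nonneg_right hdef hZ.le
    linarith [h2]
  rw [openPair_defect_eq_neg_conn_defect w hq0.ne' x y F hFe]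
  have hZ0 := rcPartitionFunctionW_pos (Function.update w s(x, y) 0) hq0 (∅ : Set V)
  rw [rcMeasureW_real_eq_sum_div _ hq0 ∅, rcMeasureW_real_eq_sum_div _ hq0 ∅, rcMeasureW_real_eq_sum_div _ hq0 ∅,
    div_mul_div_comm, div_le_div_iff₀ (mul_pos hZ0 hZ0) hZ0] at hU
  have hD : 0 ≤ (∑ ω : BondConfig V, rcWeightW (Function.update w s(x, y) 0) q ∅ ω * ind (F ∩ openConn x y) ω) *
        rcPartitionFunctionW (Function.update w s(x, y) 0) q ∅ -
      (∑ ω : BondConfig V, rcWeightW (Function.update w s(x, y) 0) q ∅ ω * ind (openConn x y) ω) *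
        (∑ ω : BondConfig V, rcWeightW (Function.update w s(x, y) 0) q ∅ ω * ind F ω) := by
    rw [Set.inter_comm]; nlinarith [hU, hZ0]
  have hc0 : 0 ≤ ((w s(x, y) : unitInterval) : ℝ) := (w s(x, y)).2.1
  have hc1 : ((w s(x, y) : unitInterval) : ℝ) ≤ 1 := (w s(x, y)).2.2
  have hr : 0 ≤ q⁻¹ - 1 := by rw [sub_nonneg]; exact (one_lt_inv_iff₀.2 ⟨hq0, hq1⟩).le
  have hfac : 0 ≤ ((w s(x, y) : unitInterval) : ℝ) * (1 - ((w s(x, y) : unitInterval) : ℝ)) * (q⁻¹ - 1) := by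
    have h1 : 0 ≤ 1 - ((w s(x, y) : unitInterval) : ℝ) := by linarith
    positivity
  nlinarith [mul_nonneg hfac hD]

omit [Fintype V] in
/-- Zeroing one coordinate keeps the support inside any set containing the old support. [folklore] -/
theorem support_update_zero_subset (w : Sym2 V → unitInterval) {S : Set (Sym2 V)}
    (hw : ∀ e, ((w e : unitInterval) : ℝ) ≠ 0 → e ∈ S) (g : Sym2 V) :
    ∀ e, ((Function.update w g 0 e : unitInterval) : ℝ) ≠ 0 → e ∈ S := by
  intro e he
  by_cases heg : e = g
  · subst heg
    rw [Function.update_self] at he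
    exact absurd rfl he
  · rw [Function.update_of_ne heg] at he
    exact hw e he

/-! ### Single-edge negative dependence on series–parallel supports (`0 < q < 1`) -/

/-- **CD at the terminal pair** (`0 < q < 1`): if `E` is a two-terminal series–parallel network between `x` and `y` and `w` is
supported in `E`, then for every increasing event `F` not depending on `xy`, `φ_{w,q}(J_{xy} ∩ F) ≤ φ_{w,q}(J_{xy})·φ_{w,q}(F)`.
[cite: Grimmett2006, §3.9 (pp. 63–64)] [cite: Wagner2006, Thm. 5.8(d), §5.3] -/
theorem edgeNegDep_of_isTTSP {q : ℝ} (hq0 : 0 < q) (hq1 : q < 1) {E : Finset (Sym2 V)} {x y : V} (hE : IsTTSP E x y)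
    (w : Sym2 V → unitInterval) (hw : ∀ e, ((w e : unitInterval) : ℝ) ≠ 0 → e ∈ (↑E : Set (Sym2 V)))
    {F : Set (BondConfig V)} (hF : IsUpperSet F) (hFe : ∀ ω : BondConfig V, ω ∆ {s(x, y)} ∈ F ↔ ω ∈ F) :
    (rcMeasureW w q ∅).real ({ω | s(x, y) ∈ ω} ∩ F) ≤
      (rcMeasureW w q ∅).real {ω | s(x, y) ∈ ω} * (rcMeasureW w q ∅).real F :=
  edgeNegDep_of_connUpCorr_at hq0 hq1 w x y hFe
    (connUpCorr_of_isTTSP hq0 hE (Function.update w s(x, y) 0) (support_update_zero_subset w hw _) hF)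

/-- **Single-edge negative dependence on series–parallel supports, every edge** (`0 < q < 1`): if `E` is a two-terminal
series–parallel network between `s` and `t` and `w` is supported in `E ∪ {st}` (a 2-connected series–parallel weighted graph
presented from one of its edges), then for EVERY pair `e` and every increasing event `F` not depending on `e`,
`φ_{w,q}(J_e ∩ F) ≤ φ_{w,q}(J_e)·φ_{w,q}(F)` — negative association with a singleton block (Grimmett 2006 §3.9) = negative
regression dependence, for all weights (hence stable under external fields and under conditioning on edge states).  `F = J_f` is
Wagner's theorem `FK.edgeNegCorr_supp_of_isTTSP`.  UNCONDITIONAL; new for `q < 1` as far as searched (BBL 2009 §3.4: not a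
consequence of the strongly-Rayleigh theory). [cite: Grimmett2006, §3.9 (pp. 63–64)] [cite: Wagner2006, Thm. 5.8(d), §5.3]
[cite: BorceaBrandenLiggett2007, Conj. 2.6, §3.4] -/
theorem edgeNegDep_supp_of_isTTSP {q : ℝ} (hq0 : 0 < q) (hq1 : q < 1) {E : Finset (Sym2 V)} {s t : V} (hE : IsTTSP E s t)
    (w : Sym2 V → unitInterval) (hw : ∀ e, ((w e : unitInterval) : ℝ) ≠ 0 → e ∈ (↑(insert s(s, t) E) : Set (Sym2 V)))
    (e : Sym2 V) {F : Set (BondConfig V)} (hF : IsUpperSet F) (hFe : ∀ ω : BondConfig V, ω ∆ {e} ∈ F ↔ ω ∈ F) :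
    (rcMeasureW w q ∅).real ({ω | e ∈ ω} ∩ F) ≤ (rcMeasureW w q ∅).real {ω | e ∈ ω} * (rcMeasureW w q ∅).real F := by
  by_cases hwe : ((w e : unitInterval) : ℝ) = 0
  · -- a pair of parameter `0` is almost surely closed
    have h0 : (rcMeasureW w q ∅).real ({ω | e ∈ ω} ∩ F) = 0 := by
      rw [rcMeasureW_real_eq_sum_div w hq0 ∅, sum_rcWeightW_ind_inter_openPair_of_zero w q hwe, zero_div]
    rw [h0]
    exact mul_nonneg measureReal_nonneg measureReal_nonneg
  · have heE : e ∈ insert s(s, t) E := hw e hwe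
    induction e using Sym2.ind with
    | h x y => exact edgeNegDep_of_isTTSP hq0 hq1 (hE.insert_edge_of_mem heE) w hw hF hFe

/-! ### On 2-tree supports (fk-1's class), through the bridge -/

section TwoTree

variable {q : ℝ} {T : Set (Sym2 V)}

/-- **UPC on 2-tree supports, every `q > 0`**: `T` a 2-tree, `xy ∈ T`, `w` supported in `T`, `F` increasing ⇒
`φ_{w,q}(x ↔ y)·φ_{w,q}(F) ≤ φ_{w,q}({x ↔ y} ∩ F)`. [cite: Grimmett2006, Thm. (3.8); §3.9 (pp. 63–64)] [cite: Wagner2006, §5.3] -/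
theorem connUpCorr_of_isTwoTree_of_pos (hq : 0 < q) (hT : IsTwoTree T) {x y : V} (hxy : s(x, y) ∈ T)
    (w : Sym2 V → unitInterval) (hw : ∀ e, ((w e : unitInterval) : ℝ) ≠ 0 → e ∈ T) {F : Set (BondConfig V)}
    (hF : IsUpperSet F) :
    (rcMeasureW w q ∅).real (openConn x y) * (rcMeasureW w q ∅).real F ≤ (rcMeasureW w q ∅).real (openConn x y ∩ F) := by
  obtain ⟨E, hE, hExy⟩ := IsTTSP.of_isTwoTree hT hxy
  exact connUpCorr_of_isTTSP hq hExy w (fun e he => hE.symm ▸ hw e he) hF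

/-- **Single-edge negative dependence on 2-tree supports, every edge** (`0 < q < 1`): `T` a 2-tree, `w` supported in `T`, `e` any
pair, `F` increasing and not depending on `e` ⇒ `φ_{w,q}(J_e ∩ F) ≤ φ_{w,q}(J_e)·φ_{w,q}(F)`.  (`F = J_f`: fk-1 g5's
`FK.edgeNegCorrSupp_of_isTwoTree`.) [cite: Grimmett2006, §3.9 (pp. 63–64)] [cite: Wagner2006, Thm. 5.8(d), §5.3] -/
theorem edgeNegDep_of_isTwoTree (hq0 : 0 < q) (hq1 : q < 1) (hT : IsTwoTree T) (w : Sym2 V → unitInterval)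
    (hw : ∀ e, ((w e : unitInterval) : ℝ) ≠ 0 → e ∈ T) (e : Sym2 V) {F : Set (BondConfig V)} (hF : IsUpperSet F)
    (hFe : ∀ ω : BondConfig V, ω ∆ {e} ∈ F ↔ ω ∈ F) :
    (rcMeasureW w q ∅).real ({ω | e ∈ ω} ∩ F) ≤ (rcMeasureW w q ∅).real {ω | e ∈ ω} * (rcMeasureW w q ∅).real F := by
  by_cases hwe : ((w e : unitInterval) : ℝ) = 0
  · have h0 : (rcMeasureW w q ∅).real ({ω | e ∈ ω} ∩ F) = 0 := by
      rw [rcMeasureW_real_eq_sum_div w hq0 ∅, sum_rcWeightW_ind_inter_openPair_of_zero w q hwe, zero_div]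
    rw [h0]
    exact mul_nonneg measureReal_nonneg measureReal_nonneg
  · have heT : e ∈ T := hw e hwe
    induction e using Sym2.ind with
    | h x y =>
      obtain ⟨E, hE, hExy⟩ := IsTTSP.of_isTwoTree hT heT
      exact edgeNegDep_of_isTTSP hq0 hq1 hExy w (fun g hg => hE.symm ▸ hw g hg) hF hFe

end TwoTree

end FK

end Summit.CriticalPhenomena.PercolationContinuityZ3.Theorems

end
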